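import Mathlib
import Literature.RingTheory.CohomologyAnnihilator.Basic
import Literature.RingTheory.CohomologyAnnihilator.SyzygyBasic
import Literature.RingTheory.CohomologyAnnihilator.SyzygyDescent
import Summits.ResolutionOfSingularities.ResolutionOfSingularities.Theorems.HomologicalConductorNoZenoExtOneExtension
import Summits.ResolutionOfSingularities.ResolutionOfSingularities.Theorems.HomologicalConductorPersistenceRecurrenceExclusion
import HarnessLib

/-!
# Rung S-2 `PersistenceSurface` (stmt-ResolutionOfSingularities-19970) — the RETRACT OBSTRUCTION to the
# one-level retract property `(SC_n)`: an `Ext¹`-injective retract of an `(n+1)`-th syzygy is projective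

Route `ResolutionOfSingularities/HomologicalConductor`, chain W4.4b, rung S-2 `PersistenceSurface`
(stmt-ResolutionOfSingularities-19970), registered skeleton 1a77c002, stub
`stub_saturationFourSurfaceResidualFour : SaturationFourSurfaceResidual₄` (`ca(T_m) ⊆ ca⁴(T_m)` at the
two-dimensional residual stages).  [OURS · pure homological algebra over LANDED tree lemmas; AI-written, weaker
than expert review; NOT a statement of the manuscript under study (Hironaka 2017) and no statement of that
manuscript is used.]  DEF-FREE: no new `def`, no conjecture.

THE METHOD UNDER TEST.  The tree's saturation engine
`RecurrenceExclusion.cohomologyAnnihilator_eq_of_forall_isSyzygy_retract_at d` derives `ca(T) = caᵈ⁺¹(T)` from the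
retract property `(SC_d)`: «every `d`-th syzygy module of a finitely generated module is a retract of a `(d+1)`-th
syzygy module of a finitely generated module».  `…PersistenceSurfaceSaturationGorenstein` VERIFIED `(SC₂)` (with
identity retractions) at every Gorenstein stage of dimension `≤ 2`, which is the Gorenstein exemption of the Sat₄
stub.  This file is the converse bookkeeping — what `(SC_n)` FORCES — so that the census of the stub can say
exactly where the engine can and cannot be fed:

* `exists_retract_X₂_of_retract_X₁_of_forall_ext_one_eq_zero` — in any abelian category with `Ext`: for a short
  exact `0 → X₁ → X₂ → X₃ → 0` and an object `W` with `Ext¹(X₃, W) = 0`, a retraction `W ⇆ X₁` extends to a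
  retraction `W ⇆ X₂` (the retraction `X₁ → W` extends over `X₁ ↪ X₂` by the tree's
  `exists_comp_eq_of_forall_ext_one_eq_zero`).
* **`moduleProjective_of_retract_isSyzygy_succ_of_forall_ext_one_eq_zero`** — THE OBSTRUCTION LEMMA: over a
  commutative ring `T`, if `Ext¹_T(K, W) = 0` for every `n`-th syzygy module `K` of every finitely generated
  module, and `W` is a retract of an `(n+1)`-th syzygy module `X = Ω(K)` (`0 → X → P → K → 0`, `P` finitely
  generated projective, `K` an `n`-th syzygy), then `W` is a retract of `P`: `W` is PROJECTIVE and finitely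
  generated.
* `forall_ext_one_eq_zero_of_le` — the orthogonality hypothesis is monotone in the level: right-`Ext¹`-orthogonal
  to all `n`-th syzygies ⇒ to all `m`-th syzygies, `m ≥ n` (noetherian `T`; peel `Ωᵐ M = Ωⁿ(Ωᵐ⁻ⁿ M)`); hence
  `moduleProjective_of_retract_isSyzygy_of_forall_ext_one_eq_zero`: such a `W` that is a retract of ANY higher
  syzygy (level `m ≥ n + 1`) is projective.
* **`moduleProjective_of_forall_isSyzygy_retract_at`** — `(SC_n)` FORCES: every `n`-th syzygy module `W` with
  `Ext¹_T(Ωⁿ(mod T), W) = 0` is projective; contrapositive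
  **`not_forall_isSyzygy_retract_at_of_not_moduleProjective`**: ONE non-projective `n`-th syzygy module `W`
  right-`Ext¹`-orthogonal to all `n`-th syzygies REFUTES `(SC_n)` at the stage.

READING FOR THE STUB (docstring level; the canonical module is not an object of the tree).  At a two-dimensional
NORMAL stage `T` (Cohen–Macaulay; second syzygies = reflexive modules = maximal Cohen–Macaulay modules, tree
`NoZeno.SandwichCluster.isReflexive_of_isSyzygy_two`) that is essentially of finite type over a field, a canonical
module `ω_T` exists, is reflexive (so a second syzygy — the dual of `Tr`), and local duality gives
`Ext¹_T(X, ω_T) = 0` for every maximal Cohen–Macaulay `X` [Bruns–Herzog, Thm. 3.3.10]; `ω_T` is free iff `T` is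
Gorenstein [Bruns–Herzog, Thm. 3.3.7].  Hence by `not_forall_isSyzygy_retract_at_of_not_moduleProjective` (n = 2):
**`(SC₂)` holds at a normal surface stage ONLY IF the stage is Gorenstein** — with
`…SaturationGorenstein.forall_isSyzygy_two_retract_three_of_ext_eq_zero` this makes the `(SC₂)` door of the Sat₄
stub EXACTLY the Gorenstein exemption already landed, and locates every further use of the one-level engine at
non-Gorenstein stages at level `3` (`(SC₃)`: «`Ω(CM)` is, up to retracts, `Ω(Ω CM)`» — for rational stages the
special Cohen–Macaulay modules of Wunram / Iyama–Wemyss), where the same lemma says: a special module `M` with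
`Ext¹_T(SCM, M) = 0` that is not free is never a retract of a fourth syzygy.

References (mechanism only): W. Bruns, J. Herzog, *Cohen–Macaulay rings*, rev. ed. 1998, §1.2, Thm. 3.3.7,
Thm. 3.3.10 [`BrunsHerzog1998`]; S. B. Iyengar, R. Takahashi, *Annihilation of cohomology and strong generation of
module categories*, IMRN 2016, §2 [`IyengarTakahashi2014`]; O. Iyama, M. Kalck, M. Wemyss, D. Yang, *Frobenius
categories, Gorenstein algebras and rational surface singularities*, Compos. Math. 151 (2015), §3 (special CM
modules `= {X ∈ CM : Ext¹(X, R) = 0}`, Frobenius structure with projectives `add D`) — context for the reading only.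
-/

noncomputable section

-- single-problem summit: the doubled namespace component `ResolutionOfSingularities` is forced
set_option linter.dupNamespace false

namespace Summit.ResolutionOfSingularities.ResolutionOfSingularities.Theorems.HomologicalConductor.PersistenceSurfaceSaturationRetractObstruction

open CategoryTheory CategoryTheory.Abelian Literature.RingTheory.CohomologyAnnihilator
open Summit.ResolutionOfSingularities.ResolutionOfSingularities.Theorems.NoZeno.SandwichCluster
  (exists_comp_eq_of_forall_ext_one_eq_zero)
open Summit.ResolutionOfSingularities.ResolutionOfSingularities.Theorems.HomologicalConductor.RecurrenceExclusion
  (finite_of_retract)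

universe w v u

/-! ## Retractions climb a short exact sequence whose cokernel is `Ext¹`-orthogonal to the retract -/

section Abelian

variable {C : Type u} [Category.{v} C] [Abelian C] [HasExt.{w} C]

/-- **Retractions climb over an `Ext¹`-orthogonal cokernel.**  For a short exact `0 → X₁ —f→ X₂ —g→ X₃ → 0` and
an object `W` with `Ext¹(X₃, W) = 0`: if `W` is a retract of `X₁` (`s ≫ r = 𝟙 W`) then `W` is a retract of `X₂`
— the retraction `r : X₁ ⟶ W` extends over `f` to `ψ : X₂ ⟶ W` (`exists_comp_eq_of_forall_ext_one_eq_zero`), and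
`(s ≫ f) ≫ ψ = s ≫ r = 𝟙 W`. [cite: BrunsHerzog1998, §1.2 (folklore)] -/
theorem exists_retract_X₂_of_retract_X₁_of_forall_ext_one_eq_zero {S : ShortComplex C} (hS : S.ShortExact)
    {W : C} (hW : ∀ e : Ext S.X₃ W 1, e = 0) (s : W ⟶ S.X₁) (r : S.X₁ ⟶ W) (hsr : s ≫ r = 𝟙 W) :
    ∃ (i : W ⟶ S.X₂) (p : S.X₂ ⟶ W), i ≫ p = 𝟙 W := by
  obtain ⟨ψ, hψ⟩ := exists_comp_eq_of_forall_ext_one_eq_zero hS hW r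
  exact ⟨s ≫ S.f, ψ, by rw [Category.assoc, hψ, hsr]⟩

end Abelian

/-! ## The obstruction lemma over a commutative ring -/

section Ring

variable {T : Type u} [CommRing T]

/-- A retract (in `ModuleCat T`) of a finitely generated projective module is a finitely generated projective
module. [folklore] -/
theorem moduleProjective_and_finite_of_retract_projective {W P : ModuleCat.{u} T} (hPfin : Module.Finite T P)
    (hP : Projective P) (i : W ⟶ P) (p : P ⟶ W) (hip : i ≫ p = 𝟙 W) :
    Module.Projective T W ∧ Module.Finite T W := by
  haveI : Module.Projective T P := moduleProjective_of_projective P hP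
  refine ⟨Module.Projective.of_split i.hom p.hom ?_, finite_of_retract i p hip hPfin⟩
  ext x
  have := congrArg (fun φ : W ⟶ W => φ.hom x) hip
  simpa using this

/-- **THE RETRACT OBSTRUCTION.**  Over a commutative ring `T`: let `W` be right-`Ext¹`-orthogonal to every `n`-th
syzygy module of every finitely generated module (`Ext¹_T(K, W) = 0` whenever `IsSyzygy n M K`, `M` finitely
generated).  If `W` is a retract of an `(n+1)`-th syzygy module `X` of a finitely generated module — i.e. of the
kernel of `0 → X → P → K → 0` with `P` finitely generated projective and `K` an `n`-th syzygy — then the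
retraction climbs to `P` (`exists_retract_X₂_of_retract_X₁_of_forall_ext_one_eq_zero`), so `W` is a finitely
generated PROJECTIVE module. [folklore] -/
theorem moduleProjective_of_retract_isSyzygy_succ_of_forall_ext_one_eq_zero {n : ℕ} {W : ModuleCat.{u} T}
    (hW : ∀ (M K : ModuleCat.{u} T), Module.Finite T M → IsSyzygy n M K → ∀ e : Ext K W 1, e = 0)
    {M X : ModuleCat.{u} T} (hM : Module.Finite T M) (hX : IsSyzygy (n + 1) M X)
    (s : W ⟶ X) (r : X ⟶ W) (hsr : s ≫ r = 𝟙 W) :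
    Module.Projective T W ∧ Module.Finite T W := by
  obtain ⟨K, P, hK, hPfin, hPproj, f, g, w, hS⟩ := hX
  obtain ⟨i, p, hip⟩ := exists_retract_X₂_of_retract_X₁_of_forall_ext_one_eq_zero
    (S := ShortComplex.mk f g w) hS (hW M K hM hK) s r hsr
  exact moduleProjective_and_finite_of_retract_projective hPfin hPproj i p hip

/-- The categorical form of the conclusion: such a `W` is a projective object of `ModuleCat T`. [folklore] -/
theorem projective_of_retract_isSyzygy_succ_of_forall_ext_one_eq_zero {n : ℕ} {W : ModuleCat.{u} T}
    (hW : ∀ (M K : ModuleCat.{u} T), Module.Finite T M → IsSyzygy n M K → ∀ e : Ext K W 1, e = 0)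
    {M X : ModuleCat.{u} T} (hM : Module.Finite T M) (hX : IsSyzygy (n + 1) M X)
    (s : W ⟶ X) (r : X ⟶ W) (hsr : s ≫ r = 𝟙 W) : Projective W := by
  haveI := (moduleProjective_of_retract_isSyzygy_succ_of_forall_ext_one_eq_zero hW hM hX s r hsr).1
  exact (IsProjective.iff_projective (R := T) W).mp inferInstance

/-! ## Monotonicity of the orthogonality hypothesis in the level -/

/-- Over a noetherian ring, an `(n + k)`-th syzygy module of a finitely generated module is an `n`-th syzygy
module of a finitely generated module (`Ωⁿ⁺ᵏ M = Ωⁿ(Ωᵏ M)`; peel `k` first syzygies with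
`isSyzygy_succ_iff_exists_first`). [folklore] -/
theorem exists_isSyzygy_of_isSyzygy_add [IsNoetherianRing T] {n : ℕ} :
    ∀ (k : ℕ) {M K : ModuleCat.{u} T}, Module.Finite T M → IsSyzygy (n + k) M K →
      ∃ M' : ModuleCat.{u} T, Module.Finite T M' ∧ IsSyzygy n M' K
  | 0, M, _, hM, hK => ⟨M, hM, hK⟩
  | k + 1, M, K, hM, hK => by
    have hK' : IsSyzygy (n + k + 1) M K := by
      simpa [Nat.add_assoc] using hK
    obtain ⟨M₁, h1, hs⟩ := isSyzygy_succ_iff_exists_first.mp hK'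
    exact exists_isSyzygy_of_isSyzygy_add k (finite_of_isSyzygy 1 hM h1) hs

/-- **The orthogonality hypothesis is monotone in the level**: over a noetherian ring, if `Ext¹_T(K, W) = 0` for
every `n`-th syzygy module `K` of a finitely generated module, then the same holds for every `m`-th syzygy module,
`m ≥ n`. [folklore] -/
theorem forall_ext_one_eq_zero_of_le [IsNoetherianRing T] {n m : ℕ} (hnm : n ≤ m) {W : ModuleCat.{u} T}
    (hW : ∀ (M K : ModuleCat.{u} T), Module.Finite T M → IsSyzygy n M K → ∀ e : Ext K W 1, e = 0) :
    ∀ (M K : ModuleCat.{u} T), Module.Finite T M → IsSyzygy m M K → ∀ e : Ext K W 1, e = 0 := by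
  intro M K hM hK e
  obtain ⟨k, rfl⟩ := Nat.exists_eq_add_of_le hnm
  obtain ⟨M', hM', hK'⟩ := exists_isSyzygy_of_isSyzygy_add k hM hK
  exact hW M' K hM' hK' e

/-- **The obstruction at every higher level**: over a noetherian ring, a module `W` right-`Ext¹`-orthogonal to all
`n`-th syzygies that is a retract of an `m`-th syzygy module of a finitely generated module for SOME `m ≥ n + 1`
is finitely generated projective. [folklore] -/
theorem moduleProjective_of_retract_isSyzygy_of_forall_ext_one_eq_zero [IsNoetherianRing T] {n m : ℕ}
    (hnm : n + 1 ≤ m) {W : ModuleCat.{u} T}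
    (hW : ∀ (M K : ModuleCat.{u} T), Module.Finite T M → IsSyzygy n M K → ∀ e : Ext K W 1, e = 0)
    {M X : ModuleCat.{u} T} (hM : Module.Finite T M) (hX : IsSyzygy m M X)
    (s : W ⟶ X) (r : X ⟶ W) (hsr : s ≫ r = 𝟙 W) :
    Module.Projective T W ∧ Module.Finite T W := by
  obtain ⟨m', rfl⟩ : ∃ m', m = m' + 1 := ⟨m - 1, by omega⟩
  exact moduleProjective_of_retract_isSyzygy_succ_of_forall_ext_one_eq_zero
    (forall_ext_one_eq_zero_of_le (by omega) hW) hM hX s r hsr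

/-! ## What the one-level retract property `(SC_n)` forces -/

/-- **`(SC_n)` FORCES `Ext¹`-INJECTIVE `n`-TH SYZYGIES TO BE PROJECTIVE.**  Under the retract property `(SC_n)`
— the hypothesis of `RecurrenceExclusion.cohomologyAnnihilator_eq_of_forall_isSyzygy_retract_at n`, VERBATIM —
every `n`-th syzygy module `W` of a finitely generated module with `Ext¹_T(K, W) = 0` for all `n`-th syzygy
modules `K` is a finitely generated projective module: `(SC_n)` makes `W` a retract of an `(n+1)`-th syzygy, and
the obstruction lemma applies. [OURS] -/
theorem moduleProjective_of_forall_isSyzygy_retract_at (n : ℕ)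
    (hSC : ∀ (M K : ModuleCat.{u} T), Module.Finite T M → IsSyzygy n M K →
      ∃ (M' K' : ModuleCat.{u} T) (i : K ⟶ K') (r : K' ⟶ K),
        Module.Finite T M' ∧ IsSyzygy (n + 1) M' K' ∧ i ≫ r = 𝟙 K)
    {M W : ModuleCat.{u} T} (hM : Module.Finite T M) (hWsyz : IsSyzygy n M W)
    (hW : ∀ (M K : ModuleCat.{u} T), Module.Finite T M → IsSyzygy n M K → ∀ e : Ext K W 1, e = 0) :
    Module.Projective T W ∧ Module.Finite T W := by
  obtain ⟨M', K', i, r, hM', hK', hir⟩ := hSC M W hM hWsyz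
  exact moduleProjective_of_retract_isSyzygy_succ_of_forall_ext_one_eq_zero hW hM' hK' i r hir

/-- **THE OBSTRUCTION TO `(SC_n)`** (contrapositive): ONE `n`-th syzygy module `W` of a finitely generated module
that is right-`Ext¹`-orthogonal to all `n`-th syzygy modules and NOT projective refutes the one-level retract
property `(SC_n)` at the stage.  Reading at `n = 2` for a non-Gorenstein normal surface stage: `W = ω_T` (a
reflexive, hence second-syzygy, module with `Ext¹(CM, ω_T) = 0`, not free) — so the `(SC₂)` door to `Sat₃` is
exactly the Gorenstein exemption. [OURS] -/
theorem not_forall_isSyzygy_retract_at_of_not_moduleProjective (n : ℕ) {M W : ModuleCat.{u} T}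
    (hM : Module.Finite T M) (hWsyz : IsSyzygy n M W)
    (hW : ∀ (M K : ModuleCat.{u} T), Module.Finite T M → IsSyzygy n M K → ∀ e : Ext K W 1, e = 0)
    (hnp : ¬ Module.Projective T W) :
    ¬ ∀ (M K : ModuleCat.{u} T), Module.Finite T M → IsSyzygy n M K →
      ∃ (M' K' : ModuleCat.{u} T) (i : K ⟶ K') (r : K' ⟶ K),
        Module.Finite T M' ∧ IsSyzygy (n + 1) M' K' ∧ i ≫ r = 𝟙 K :=
  fun hSC => hnp (moduleProjective_of_forall_isSyzygy_retract_at n hSC hM hWsyz hW).1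

/-- **The obstruction at every level above**: the same `W` (an `n`-th syzygy, `Ext¹`-orthogonal to all `n`-th
syzygies, not projective) is not a retract of ANY `m`-th syzygy module of a finitely generated module for any
`m ≥ n + 1` (noetherian `T`) — in particular no recurrent class of `RecurrenceExclusion` containing `W` consists of
retracts of high syzygies. [OURS] -/
theorem not_retract_isSyzygy_of_not_moduleProjective [IsNoetherianRing T] {n m : ℕ} (hnm : n + 1 ≤ m)
    {W : ModuleCat.{u} T}
    (hW : ∀ (M K : ModuleCat.{u} T), Module.Finite T M → IsSyzygy n M K → ∀ e : Ext K W 1, e = 0)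
    (hnp : ¬ Module.Projective T W) {M X : ModuleCat.{u} T} (hM : Module.Finite T M) (hX : IsSyzygy m M X)
    (s : W ⟶ X) (r : X ⟶ W) : s ≫ r ≠ 𝟙 W :=
  fun hsr => hnp (moduleProjective_of_retract_isSyzygy_of_forall_ext_one_eq_zero hnm hW hM hX s r hsr).1

/-! ## Nesting of the levels: `(SC_d) ⇒ (SC_m)` for `m ≥ d` (append #1) -/

/-- **The one-level retract properties are NESTED**: over a noetherian ring, `(SC_d)` implies `(SC_m)` for every
`m ≥ d` — an `m`-th syzygy module of a finitely generated module is a `d`-th syzygy module of a finitely generated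
module (`exists_isSyzygy_of_isSyzygy_add`), hence under `(SC_d)` a retract of an `(m+1)`-th syzygy module
(`RecurrenceExclusion.exists_retract_isSyzygy_of_forall_isSyzygy_retract`).  So feeding the saturation engine at
level `3` (`(SC₃)`, the level forced at non-Gorenstein normal surface stages by the obstruction above) is a WEAKER
demand than `(SC₂)`, never a different one. [folklore] -/
theorem forall_isSyzygy_retract_at_mono [IsNoetherianRing T] {d m : ℕ} (hdm : d ≤ m)
    (hSC : ∀ (M K : ModuleCat.{u} T), Module.Finite T M → IsSyzygy d M K →
      ∃ (M' K' : ModuleCat.{u} T) (i : K ⟶ K') (r : K' ⟶ K),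
        Module.Finite T M' ∧ IsSyzygy (d + 1) M' K' ∧ i ≫ r = 𝟙 K) :
    ∀ (M K : ModuleCat.{u} T), Module.Finite T M → IsSyzygy m M K →
      ∃ (M' K' : ModuleCat.{u} T) (i : K ⟶ K') (r : K' ⟶ K),
        Module.Finite T M' ∧ IsSyzygy (m + 1) M' K' ∧ i ≫ r = 𝟙 K := by
  intro M K hM hK
  obtain ⟨k, rfl⟩ := Nat.exists_eq_add_of_le hdm
  obtain ⟨M₀, hM₀, hK₀⟩ := exists_isSyzygy_of_isSyzygy_add k hM hK
  obtain ⟨Y, N, i, r, hY, hN, hir⟩ :=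
    RecurrenceExclusion.exists_retract_isSyzygy_of_forall_isSyzygy_retract d hSC (d + k + 1) hM₀ hK₀
  exact ⟨Y, N, i, r, hY, hN, hir⟩

/-- **`(SC_d)` forces `Ext¹`-injective syzygies to be projective at EVERY level `m ≥ d`**: under `(SC_d)`, an `m`-th
syzygy module `W` of a finitely generated module with `Ext¹_T(K, W) = 0` for all `m`-th syzygy modules `K` is finitely
generated projective (`forall_isSyzygy_retract_at_mono` + `moduleProjective_of_forall_isSyzygy_retract_at`). [OURS] -/
theorem moduleProjective_of_forall_isSyzygy_retract_at_of_le [IsNoetherianRing T] {d m : ℕ} (hdm : d ≤ m)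
    (hSC : ∀ (M K : ModuleCat.{u} T), Module.Finite T M → IsSyzygy d M K →
      ∃ (M' K' : ModuleCat.{u} T) (i : K ⟶ K') (r : K' ⟶ K),
        Module.Finite T M' ∧ IsSyzygy (d + 1) M' K' ∧ i ≫ r = 𝟙 K)
    {M W : ModuleCat.{u} T} (hM : Module.Finite T M) (hWsyz : IsSyzygy m M W)
    (hW : ∀ (M K : ModuleCat.{u} T), Module.Finite T M → IsSyzygy m M K → ∀ e : Ext K W 1, e = 0) :
    Module.Projective T W ∧ Module.Finite T W :=
  moduleProjective_of_forall_isSyzygy_retract_at m (forall_isSyzygy_retract_at_mono hdm hSC) hM hWsyz hW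

end Ring

end Summit.ResolutionOfSingularities.ResolutionOfSingularities.Theorems.HomologicalConductor.PersistenceSurfaceSaturationRetractObstruction

end
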